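import Literature.Analysis.FluidPDE.NormalisedPressureDisjointAdd
import Literature.Analysis.FluidPDE.LocalLerayPressureDecompositionProofs
import Literature.Analysis.FluidPDE.LerayPressureDecayProofs
import Literature.Analysis.FluidPDE.LerayPressureDecayReduction
import Literature.Analysis.FluidPDE.RieszPressureLocality
import Literature.Analysis.FluidPDE.TaoEnergyLocalisationPressure
import Literature.Analysis.FluidPDE.NSSereginDecayPressureNear
import HarnessLib

/-!
# Strain doors, PART M §M29(a)–(b) — LINK 1, first half: the near-field pressure is LINEAR in the local energy
# under a sup bound; the near/far/constant split of the Riesz pressure of ONE finite-energy slice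

ROUND 70 of the `ns-regularity-ideate` programme (p1 line; helper lane of `stmt-NavierStokesRegularity-0056`,
rung N0; nothing here is a claim about Navier–Stokes regularity).  ROUND 69 proved door X′ (the `L²`-Morrey Type-I
bound from the sup-norm rate IN THE ENERGY CLASS, constant `M₂(M, ‖u₀‖₂, T₀)`) and typed door X″
`UlocMorreyBoundSupTypeI`: the same bound with an `M`-ONLY constant at all radii `r² < T`.  ROUND 70 CLOSES X″ by a
uniformly-local energy Grönwall argument under the rate, in three links, ALL PROVED: LINK 1 (the pressure pairing of
the local energy inequality is LINEAR in the local energies under a sup bound, `M`-free constants — texts N11a/N11b),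
LINK 2 (the sliced local energy inequality under the rate at unit scale is linear with `M`-only data — typed in N11c,
PROVED in N11e/N11f/N11g), LINK 3 (LINK 2 ⇒ X″ by Grönwall and Leray rescaling — N11c); N11d puts them together:
`ulocMorreyBoundSupTypeI_holds : UlocMorreyBoundSupTypeI`.

THIS FILE (tree-only imports, all served by the farm):
* §M29(a) `exists_eLpNorm_nearPressure_two_le_linear` — `‖p̃[1_B w]‖₂ ≤ C K_b ‖1_B w‖₂` for `|w| ≤ K_b` on the ball
  `B` (Stein at `p = 2` applied to `|1_B w|² ≤ K_b |1_B w|`): ONE power of the sup bound (the tree's Jia–Šverák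
  form `≤ C K_b² |B|^{1/2}` is quadratic);
* §M29(b) `normalisedPressure_eq_near_add_far_add_const` — for a measurable slice with `|w|² ∈ L¹ ∩ L^{3/2}`:
  `p̃[w] = p̃[1_{B_{2r}} w] + ∫_{B_{2r}ᶜ} (K(x−y) − K(x₀−y)) w⊗w + c` a.e. on `B(x₀, r)`, `c` independent of `x`
  (disjoint-support additivity of principal values, Ożański 2017 Lemma 4 (iii); the far principal value is a plain
  integral, `hasPressurePV_of_eq_zero_on_ball`) — Kang–Miura–Tsai's Lemma 3.4 / Jia–Šverák (3.3) for one slice of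
  finite energy, with no local-Leray structure and no mollified pressures.
Helpers: `norm_indicator_sq`, `le_norm_sub_of_mem_ball_of_notMem`, `integrableOn_pressureKernel_far` (the slice
measurability of `p̃[w]` is the tree's `aestronglyMeasurable_normalisedPressure_of_sq_integrable`, cited by name at landing —
hand ns-s29-p2 g7, gate `dedup.landed`).  No `sorry`, no new axioms, no instances, no notation, no definitions.
-/

noncomputable section

set_option linter.dupNamespace false

open MeasureTheory Set Function Filter Metric Real
open _root_.Topology
open scoped ENNReal NNReal RealInnerProductSpace
open Literature.Analysis Literature.Analysis.FluidPDE

namespace Summit.NavierStokesRegularity.NavierStokesRegularity.Theorems.StrainDoors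

/-! ### §M29(a) The near-field pressure of a bounded slice: an `L²` bound LINEAR in the local energy -/

/-- `‖1_B w‖² = 1_B ‖w‖²` pointwise. [folklore] -/
theorem norm_indicator_sq (s : Set (EuclideanSpace ℝ (Fin 3)))
    (w : EuclideanSpace ℝ (Fin 3) → EuclideanSpace ℝ (Fin 3)) (y : EuclideanSpace ℝ (Fin 3)) :
    ‖s.indicator w y‖ ^ 2 = s.indicator (fun y => ‖w y‖ ^ 2) y := by
  by_cases hy : y ∈ s
  · rw [indicator_of_mem hy, indicator_of_mem hy]
  · rw [indicator_of_notMem hy, indicator_of_notMem hy, norm_zero]; ring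

/-- **§M29(a) The near-field pressure is LINEAR in the local energy under a sup bound.**  There is
an absolute `C` such that for every measurable slice `w` with `∫_{B(x₀,ρ)} |w|² < ∞` and
`|w| ≤ K_b` on `B(x₀, ρ)`, the near-field pressure `p̃[1_{B(x₀,ρ)} w]` (the tree's
`localPressureNear x₀ (ρ/2)`) satisfies `‖p̃[1_{B(x₀,ρ)} w]‖_{L²(ℝ³)} ≤ C · K_b · ‖1_{B(x₀,ρ)} w‖_{L²}`
— ONE power of the sup bound and ONE power of the local `L²` norm (the Calderón–Zygmund bound
`stein1970_normalisedPressure_ae_Lp_bound_holds` at `p = 2` applied to `|1_B w|² ≤ K_b |1_B w|`),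
as opposed to the quadratic form `≤ C K_b² |B|^{1/2}` (Jia–Šverák 2014 (3.3), the tree's
`JiaSverak2014.exists_eLpNorm_localPressureNear_le_of_bound`).  Under the Type-I rate
`K_b = M/√(T − s)` this makes the near-pressure term of the local energy inequality linear in the
local energy with a time-integrable weight. [cite: Stein1970, Ch. II §4.2 Thm 3] [cite: JiaSverak2014, formula (3.3) p. 7] -/
theorem exists_eLpNorm_nearPressure_two_le_linear :
    ∃ C : ℝ≥0, ∀ {w : EuclideanSpace ℝ (Fin 3) → EuclideanSpace ℝ (Fin 3)}
      {x₀ : EuclideanSpace ℝ (Fin 3)} {ρ Kb : ℝ}, 0 ≤ Kb → AEStronglyMeasurable w volume →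
      IntegrableOn (fun y => ‖w y‖ ^ 2) (ball x₀ ρ) volume →
      (∀ y ∈ ball x₀ ρ, ‖w y‖ ≤ Kb) →
      eLpNorm (normalisedPressure ((ball x₀ ρ).indicator w)) 2 volume ≤
        C * ENNReal.ofReal Kb * eLpNorm ((ball x₀ ρ).indicator w) 2 volume := by
  obtain ⟨C, hC⟩ := stein1970_normalisedPressure_ae_Lp_bound_holds 2 (by norm_num) ENNReal.ofNat_lt_top
  refine ⟨C, fun {w} {x₀} {ρ} {Kb} hKb hw hint hb => ?_⟩
  set a : EuclideanSpace ℝ (Fin 3) → EuclideanSpace ℝ (Fin 3) := (ball x₀ ρ).indicator w with ha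
  have ham : AEStronglyMeasurable a volume := hw.indicator measurableSet_ball
  have ha2int : Integrable (fun y => ‖a y‖ ^ 2) volume := by
    have : (fun y => ‖a y‖ ^ 2) = (ball x₀ ρ).indicator (fun y => ‖w y‖ ^ 2) :=
      funext fun y => norm_indicator_sq _ w y
    rw [this]
    exact hint.integrable_indicator measurableSet_ball
  have hamem : MemLp a 2 volume := (memLp_two_iff_integrable_sq_norm ham).2 ha2int
  have hpt : ∀ᵐ y ∂(volume : Measure (EuclideanSpace ℝ (Fin 3))),
      ‖‖a y‖ ^ 2‖ ≤ Kb.toNNReal * ‖a y‖ := by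
    refine Eventually.of_forall fun y => ?_
    rw [Real.norm_eq_abs, abs_of_nonneg (sq_nonneg _), Real.coe_toNNReal _ hKb]
    by_cases hy : y ∈ ball x₀ ρ
    · rw [ha, indicator_of_mem hy, sq]
      exact mul_le_mul_of_nonneg_right (hb y hy) (norm_nonneg _)
    · rw [ha, indicator_of_notMem hy, norm_zero]; simp
  have hmem2 : MemLp (fun y => ‖a y‖ ^ 2) 2 volume :=
    MemLp.of_le_mul hamem ((continuous_norm.pow 2).comp_aestronglyMeasurable ham) hpt
  have hle : eLpNorm (fun y => ‖a y‖ ^ 2) 2 volume ≤ Kb.toNNReal • eLpNorm a 2 volume :=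
    eLpNorm_le_nnreal_smul_eLpNorm_of_ae_le_mul hpt 2
  obtain ⟨-, hCZ⟩ := hC a ham hmem2
  calc eLpNorm (normalisedPressure a) 2 volume
      ≤ C * eLpNorm (fun y => ‖a y‖ ^ 2) 2 volume := hCZ
    _ ≤ C * (Kb.toNNReal • eLpNorm a 2 volume) := by gcongr
    _ = C * ENNReal.ofReal Kb * eLpNorm a 2 volume := by
      rw [ENNReal.smul_def, smul_eq_mul, mul_assoc]; rfl

/-! ### §M29(b) The near/far/constant split of the Riesz pressure of a finite-energy slice -/

/-- For `x` at distance `< r` from `x₀` and `y` outside `B(x₀, 2r)`: `‖x − y‖ ≥ r`. [folklore] -/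
theorem le_norm_sub_of_mem_ball_of_notMem {x₀ x y : EuclideanSpace ℝ (Fin 3)} {r : ℝ}
    (hx : x ∈ ball x₀ r) (hy : y ∈ (ball x₀ (2 * r))ᶜ) : r ≤ ‖x - y‖ := by
  rw [mem_compl_iff, mem_ball, not_lt, dist_eq_norm] at hy
  rw [mem_ball, dist_eq_norm] at hx
  have h1 : ‖y - x₀‖ ≤ ‖y - x‖ + ‖x - x₀‖ := norm_sub_le_norm_sub_add_norm_sub y x x₀
  rw [← norm_neg (y - x), neg_sub] at h1
  linarith

/-- The unsubtracted far-field integrand of an `L²` slice is integrable: for `x ∈ B(x₀, r)`,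
`y ↦ K(x − y)(w(y))` is integrable on `B(x₀, 2r)ᶜ`, being bounded there by `|w(y)|²/(2π r³)`.
[folklore] -/
theorem integrableOn_pressureKernel_far {w : EuclideanSpace ℝ (Fin 3) → EuclideanSpace ℝ (Fin 3)}
    (hw : AEStronglyMeasurable w volume) (hw2 : Integrable (fun y => ‖w y‖ ^ 2) volume)
    {x₀ x : EuclideanSpace ℝ (Fin 3)} {r : ℝ} (hr : 0 < r) (hx : x ∈ ball x₀ r) :
    IntegrableOn (fun y => pressureKernel (x - y) (w y)) (ball x₀ (2 * r))ᶜ volume := by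
  have hm : AEStronglyMeasurable (fun y => pressureKernel (x - y) (w y))
      (volume.restrict (ball x₀ (2 * r))ᶜ) :=
    (aestronglyMeasurable_pressureKernel_sub_apply hw x).restrict
  refine Integrable.mono' ((hw2.div_const (2 * Real.pi * r ^ 3)).integrableOn) hm ?_
  rw [ae_restrict_iff' measurableSet_ball.compl]
  refine Eventually.of_forall fun y hy => ?_
  have hxy : r ≤ ‖x - y‖ := le_norm_sub_of_mem_ball_of_notMem hx hy
  rw [Real.norm_eq_abs]
  refine (abs_pressureKernel_le (x - y) (w y)).trans ?_
  have hπ : 0 < Real.pi := Real.pi_pos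
  have hr3 : r ^ 3 ≤ ‖x - y‖ ^ 3 := pow_le_pow_left₀ hr.le hxy 3
  exact div_le_div_of_nonneg_left (sq_nonneg _) (by positivity) (by nlinarith)

/-- **The principal value of an `L²` field vanishing on a ball about `x` is the plain integral**:
if `b ∈ L²` (measurable, `|b|² ∈ L¹`) and `b = 0` on `B(x, δ)`, then `HasPressurePV b x (∫ K(x−y)(b y) dy)`
(the truncated integrals are eventually constant).  The tree's `hasPressurePV_of_eqOn_ball` is the
same statement for continuous `b`. [folklore] -/
theorem hasPressurePV_of_eq_zero_on_ball {b : EuclideanSpace ℝ (Fin 3) → EuclideanSpace ℝ (Fin 3)}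
    (hb : AEStronglyMeasurable b volume) (hb2 : Integrable (fun y => ‖b y‖ ^ 2) volume)
    {x : EuclideanSpace ℝ (Fin 3)} {δ : ℝ} (hδ : 0 < δ) (h0 : ∀ y ∈ ball x δ, b y = 0) :
    HasPressurePV b x (∫ y, pressureKernel (x - y) (b y)) := by
  -- the integrand is globally integrable: it vanishes on `B(x, δ)` and is `≤ |b|²/(2π δ³)` outside
  have hm : AEStronglyMeasurable (fun y => pressureKernel (x - y) (b y)) volume :=
    aestronglyMeasurable_pressureKernel_sub_apply hb x
  have hI : Integrable (fun y => pressureKernel (x - y) (b y)) volume := by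
    refine Integrable.mono' (hb2.div_const (2 * Real.pi * δ ^ 3)) hm (Eventually.of_forall fun y => ?_)
    by_cases hy : y ∈ ball x δ
    · rw [h0 y hy, pressureKernel_zero_right, norm_zero]
      positivity
    · rw [mem_ball, not_lt, dist_eq_norm, ← norm_neg, neg_sub] at hy
      rw [Real.norm_eq_abs]
      refine (abs_pressureKernel_le (x - y) (b y)).trans ?_
      have hπ : 0 < Real.pi := Real.pi_pos
      have h3 : δ ^ 3 ≤ ‖x - y‖ ^ 3 := pow_le_pow_left₀ hδ.le hy 3
      exact div_le_div_of_nonneg_left (sq_nonneg _) (by positivity) (by nlinarith)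
  refine ⟨Eventually.of_forall fun ε => hI.integrableOn, ?_⟩
  -- the truncated integrals equal the full integral for `ε < δ`
  have hev : ∀ᶠ ε in 𝓝[>] (0 : ℝ), truncatedPressureIntegral b x ε = ∫ y, pressureKernel (x - y) (b y) := by
    have hmem : Ioo (0 : ℝ) δ ∈ 𝓝[>] (0 : ℝ) := Ioo_mem_nhdsGT hδ
    filter_upwards [hmem] with ε hε
    unfold truncatedPressureIntegral
    rw [← integral_indicator measurableSet_closedBall.compl]
    refine integral_congr_ae (Eventually.of_forall fun y => ?_)
    by_cases hy : y ∈ (closedBall x ε)ᶜ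
    · rw [indicator_of_mem hy]
    · rw [indicator_of_notMem hy]
      rw [mem_compl_iff, not_not, mem_closedBall] at hy
      have hyδ : y ∈ ball x δ := mem_ball.2 (lt_of_le_of_lt hy hε.2)
      show (0 : ℝ) = pressureKernel (x - y) (b y)
      rw [h0 y hyδ, pressureKernel_zero_right]
  exact (tendsto_const_nhds.congr' (hev.mono fun ε hε => hε.symm))

/-- **§M29(b) `p̃[w] = π_near + π_far + c` on `B(x₀, r)` for a finite-energy `L³` slice.**  Let `w` be
measurable with `|w|² ∈ L¹ ∩ L^{3/2}`.  Then for every centre `x₀` and radius `r > 0`, for a.e.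
`x ∈ B(x₀, r)`,

  `p̃[w](x) = p̃[1_{B(x₀,2r)} w](x) + ∫_{B(x₀,2r)ᶜ} (K(x−y) − K(x₀−y))(w(y)) dy + c`,
  `c = ∫_{B(x₀,2r)ᶜ} K(x₀−y)(w(y)) dy ∈ ℝ`,

i.e. `p̃[w] = localPressureNear x₀ r + localPressureFar x₀ r + c` with `c` independent of `x`
(Kang–Miura–Tsai 2021 Lemma 3.4 / Jia–Šverák 2014 (3.3), here for ONE slice of finite energy
rather than for a local Leray solution: `w = 1_B w + 1_{Bᶜ} w` is a disjointly supported sum, the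
principal values add (`normalisedPressure_add_of_disjoint`, Ożański 2017 Lemma 4 (iii)), the near
one exists a.e. by Stein's theorem and the far one is a plain absolutely convergent integral
(`hasPressurePV_of_eq_zero_on_ball`); no mollified pressures and no slice pressure-gradient identity
are needed).  [cite: KangMiuraTsai2020, Lemma 3.4 (pressure decomposition), arXiv:1812.10509 p. 8] [cite: JiaSverak2014, formula (3.3) p. 7] [cite: Ozanski2017NSISingular, Lemma 4 (iii)] -/
theorem normalisedPressure_eq_near_add_far_add_const
    {w : EuclideanSpace ℝ (Fin 3) → EuclideanSpace ℝ (Fin 3)} (hw : AEStronglyMeasurable w volume)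
    (hw2 : Integrable (fun y => ‖w y‖ ^ 2) volume)
    (hw3 : MemLp (fun y => ‖w y‖ ^ 2) (3 / 2 : ℝ≥0∞) volume) (x₀ : EuclideanSpace ℝ (Fin 3))
    {r : ℝ} (hr : 0 < r) :
    ∀ᵐ x : EuclideanSpace ℝ (Fin 3), x ∈ ball x₀ r →
      normalisedPressure w x = normalisedPressure ((ball x₀ (2 * r)).indicator w) x +
        (∫ y in (ball x₀ (2 * r))ᶜ, (pressureKernel (x - y) (w y) - pressureKernel (x₀ - y) (w y))) +
        ∫ y in (ball x₀ (2 * r))ᶜ, pressureKernel (x₀ - y) (w y) := by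
  set a : EuclideanSpace ℝ (Fin 3) → EuclideanSpace ℝ (Fin 3) := (ball x₀ (2 * r)).indicator w with ha
  set b : EuclideanSpace ℝ (Fin 3) → EuclideanSpace ℝ (Fin 3) := (ball x₀ (2 * r))ᶜ.indicator w with hb
  have ham : AEStronglyMeasurable a volume := hw.indicator measurableSet_ball
  have hbm : AEStronglyMeasurable b volume := hw.indicator measurableSet_ball.compl
  have hab : ∀ y, a y = 0 ∨ b y = 0 := fun y => by
    by_cases hy : y ∈ ball x₀ (2 * r)
    · exact Or.inr (by rw [hb, indicator_of_notMem (fun h => (Set.mem_compl_iff _ _).1 h hy)])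
    · exact Or.inl (by rw [ha, indicator_of_notMem hy])
  have hwab : w = a + b := by
    funext y
    rw [Pi.add_apply, ha, hb]
    exact (Set.indicator_self_add_compl_apply (ball x₀ (2 * r)) w y).symm
  -- Stein: the near principal value exists a.e.
  have ha3 : MemLp (fun y => ‖a y‖ ^ 2) (3 / 2 : ℝ≥0∞) volume := by
    have : (fun y => ‖a y‖ ^ 2) = (ball x₀ (2 * r)).indicator (fun y => ‖w y‖ ^ 2) :=
      funext fun y => norm_indicator_sq _ w y
    rw [this]
    exact hw3.indicator measurableSet_ball
  have h32 : (1 : ℝ≥0∞) < 3 / 2 := by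
    rw [ENNReal.lt_div_iff_mul_lt (Or.inl two_ne_zero) (Or.inl ENNReal.ofNat_ne_top)]; norm_num
  have h32t : (3 / 2 : ℝ≥0∞) < ⊤ := ENNReal.div_lt_top ENNReal.ofNat_ne_top two_ne_zero
  obtain ⟨C', hC'⟩ := stein1970_normalisedPressure_ae_Lp_bound_holds (3 / 2) h32 h32t
  obtain ⟨hPVa, -⟩ := hC' a ham ha3
  -- the far field: `b` is `L²` and vanishes on `B(x, r)` for `x ∈ B(x₀, r)`
  have hb2 : Integrable (fun y => ‖b y‖ ^ 2) volume := by
    have : (fun y => ‖b y‖ ^ 2) = (ball x₀ (2 * r))ᶜ.indicator (fun y => ‖w y‖ ^ 2) :=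
      funext fun y => norm_indicator_sq _ w y
    rw [this]
    exact hw2.indicator measurableSet_ball.compl
  have hx₀ : x₀ ∈ ball x₀ r := mem_ball_self hr
  have hI₀ := integrableOn_pressureKernel_far hw hw2 hr hx₀
  filter_upwards [hPVa] with x hxa hxr
  have hx2 : x ∈ ball x₀ (2 * r) := ball_subset_ball (by linarith) hxr
  -- `b = 0` on `B(x, r) ⊆ B(x₀, 2r)`
  have hb0 : ∀ y ∈ ball x r, b y = 0 := by
    intro y hy
    have hy2 : y ∈ ball x₀ (2 * r) := by
      rw [mem_ball] at hy hxr ⊢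
      linarith [dist_triangle y x x₀]
    rw [hb, indicator_of_notMem (fun h => (Set.mem_compl_iff _ _).1 h hy2)]
  have hPVb := hasPressurePV_of_eq_zero_on_ball hbm hb2 hr hb0
  have hsum := normalisedPressure_add_of_disjoint hab hxa ⟨_, hPVb⟩
  rw [← hwab] at hsum
  rw [hsum, normalisedPressure_eq hPVb, hb0 x (mem_ball_self hr), norm_zero]
  simp only [ne_eq, OfNat.ofNat_ne_zero, not_false_eq_true, zero_pow, neg_zero, zero_div, zero_add]
  -- `∫ K(x−y)(b y) = ∫_{B(x₀,2r)ᶜ} K(x−y)(w y) = π_far(x) + c`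
  have hbint : (fun y => pressureKernel (x - y) (b y)) =
      (ball x₀ (2 * r))ᶜ.indicator fun y => pressureKernel (x - y) (w y) := by
    funext y
    by_cases hy : y ∈ (ball x₀ (2 * r))ᶜ
    · rw [indicator_of_mem hy, hb, indicator_of_mem hy]
    · rw [indicator_of_notMem hy, hb, indicator_of_notMem hy, pressureKernel_zero_right]
  have hIx := integrableOn_pressureKernel_far hw hw2 hr hxr
  rw [hbint, integral_indicator measurableSet_ball.compl, add_assoc, add_right_inj,
    integral_sub hIx hI₀, sub_add_cancel]

end Summit.NavierStokesRegularity.NavierStokesRegularity.Theorems.StrainDoors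

end
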